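import Summits.AtomisticToContinuum.Crystallization.Theorems.FrustratedLawDichotomyStrainedPatchHomExteriorColumnV3

/-!
# Strained patch, `(H)` hcp exterior certificate (architecture R3) — E3: ★ THE CELL-BACKED EXTERIOR LEAF (critic g32 row 1484 (B)(ii), the MOAT closure of record)
# and the SEVEN-KIND column menu `colLeaf7`  (decomp-a2c hand 2, generation 39; structural #21)

Row 1484 (B): v2 (`exteriorOK2`, p854134) is necessary but not sufficient at natural cell size — between the reference range `[cC ± jw]` and the first
dominated slab a MOAT of width `(4/3)·ρ_dom` remains.  Closure (ii) «cell-backed near case»: the leaf's soundness takes, besides its own exterior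
certificate, the ADJACENT CELL's semantic fact and discharges the configurations with `‖U(ξ − ξ₀(U))‖ < r/SC` by the CELL (they lie in the cell's box),
the rest by ray domination with the tube radius `r` in place of a coordinate gap — so the leaf box may start AT (or even overlap) the cell face.

* §1 `extRest3` / ★ `exteriorOK3 := extRest3 && extCurvAll` — v2 with the gap clause REPLACED by an explicit integer tube radius `r > 0` in the domination
  inequality `4·SC²·8892·6⁷ + 4·SC·htGsA2·6⁷7⁷ + 4·SC²·|htRU|·7⁷ < 4·lmin·r·6⁷7⁷` (⟺ `S₇♯ + f₀ + |R|·6⁻⁷ < (lmin/SC)·(r/SC)`); `exteriorOK3_of_parts`;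
  ★ `exteriorOK3_sound_far`: the `hver` conclusion for every admissible `(U, ξ)` of the box with `r/SC ≤ ‖U(ξ − affShuf J cC U)‖`.
* §2 `tubeBoxOK J cC wC r cN wN c w` (same `U`-box as the cell `(cC, wC)` and as the backing box `(cN, wN)`; integer containment
  `[cC ± (jw + 4r/3)] ⊆ [cN ± wN]` per shuffle axis) and `xi_mem_of_near`: the near configurations lie in the backing box.
* §3 ★★★ `semOKH_of_cellBacked (hN : semOKH μ cN wN) (h3 : exteriorOK3 …) (ht : tubeBoxOK …) : semOKH μ c w` — every level `μ`.
* §4 `cellBackedAt L n e` (backing box = the LISTED cell `L[n]`, exterior data `e : ExtLeafData` with `e.g` READ AS THE TUBE RADIUS `r`, `e.i` unused),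
  `cellBackedAt_sound`, the seven-kind menu `colLeaf7` (= `colLeaf6` + `ℕ × ExtLeafData`), `semOKH_of_cutOK_colLeaf7`, ★ `semOKH_root_of_colManifest7`.

Driver reading (hand-1 g41, G4′ of record): list the natural cell `N` (its own certificate) in `L`; emit the hull box / the face slabs adjacent to `N` as
`cellBackedAt n e` leaves with `r := ⌈ρ_dom·SC⌉` from the leaf's own chain floors and `N ⊇ [cC ± (jw + 4r/3)]` on the shuffle axes (the cell box must contain
the `4r/3`-tube of the reference range — a condition on the CELL'S ξ-half-width `wC − jw ≥ 4r/3`, not on the slab); slabs further out stay v2.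
0 sorry; standard axioms; computable defs.  `--supports stmt-AtomisticToContinuum-27623`.
-/

noncomputable section

open Set

namespace Summit.AtomisticToContinuum.Crystallization.Theorems.FrustratedLawDichotomyStrainedPatchHomExteriorRay

open scoped BigOperators RealInnerProductSpace
open Literature.Analysis.ValidatedNumerics.Numerics
open Summit.AtomisticToContinuum.Crystallization.Theorems.ChargedEnergyGapNegative (E3)
open Summit.AtomisticToContinuum.Crystallization.Theorems.FrustratedLawDichotomySchurCut (effPot w₄₅ ω₄)
open Summit.AtomisticToContinuum.Crystallization.Theorems.FrustratedLawDichotomyAveragingRuleTightFree (TightNearCap BadNearCap)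
open Summit.AtomisticToContinuum.Crystallization.Theorems.FrustratedLawDichotomyExemptAbsorption (ExemptNear)
open Summit.AtomisticToContinuum.Crystallization.Theorems.FrustratedLawDichotomyStrainedPatchHomSplit (ExRec latPt hexFrame hcpShift)
open Summit.AtomisticToContinuum.Crystallization.Theorems.FrustratedLawDichotomyStrainedPatchTaylorChord (segGd)
open Summit.AtomisticToContinuum.Crystallization.Theorems.FrustratedLawDichotomyStrainedPatchHomCurvLeaf (nodup_filter_append toFinset_filter_append)
open Summit.AtomisticToContinuum.Crystallization.Theorems.FrustratedLawDichotomyStrainedPatchHomCurvLJ (curvCheckLJM ljLabelOK)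
open Summit.AtomisticToContinuum.Crystallization.Theorems.FrustratedLawDichotomyStrainedPatchHomForceJacN (fjQ boxLabels11 boxLabels11_toFinset)
open Summit.AtomisticToContinuum.Crystallization.Theorems.FrustratedLawDichotomyStrainedPatchHomForceHcp (xiBallOK norm_le_quarter_of_xiBallOK)
open Summit.AtomisticToContinuum.Crystallization.Theorems.FrustratedLawDichotomyStrainedPatchHomSlopeLJAffine (affShuf abs_affShuf_sub_le jw)
open Summit.AtomisticToContinuum.Crystallization.Theorems.FrustratedLawDichotomyStrainedPatchHomEntryLeafHT (htBU htRU htUniv htIn htK htROKU htBU_nodup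
  htNaiOKA2 htGsA2 refForce_chunkA2_le jacOK jacOK_spec norm_le_seven_of_htIn lo_le_of_norm_le_seven six_le_norm_of_lo seven_lt_norm_of_not_mem_htUniv
  mem_boxLabels11_of_mem_htUniv mem_htUniv_of_mem_htBU htIn_of_mem_htBU mem_htBU_of_htIn)
open Summit.AtomisticToContinuum.Crystallization.Theorems.FrustratedLawDichotomyStrainedPatchHomEntryLeafHT (semOKH semOKH_anti_box semOKH_forall semOKH_of_forall
  hcpCoord HcpLeafGoal inHcpBox_iff)
open Summit.AtomisticToContinuum.Crystallization.Theorems.FrustratedLawDichotomyStrainedPatchHomEntryGramHcp (rootCH rootWH)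
open Summit.AtomisticToContinuum.Crystallization.Theorems.FrustratedLawDichotomyStrainedPatchHomForceCentredHcp (entryLeafOKHC)
open Summit.AtomisticToContinuum.Crystallization.Theorems.FrustratedLawDichotomyStrainedPatchHomLatticeBox (norm_apply_ge_of_near_one)
open Summit.AtomisticToContinuum.Crystallization.Theorems.FrustratedLawDichotomyStrainedPatchHomCutTree (CutTree cutOK coveredAt coveredAt_sound
  semOKH_of_cutOK_leaves semOKH_of_entryLeafOKHC_level)

/-! ## §1 The exterior leaf with an explicit tube radius (no gap clause) and its FAR soundness -/

/-- Everything of the tube-radius exterior leaf EXCEPT the per-box curvature certificates: v2's `extRest2` with the coordinate-gap clause replaced by the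
integer tube radius `r > 0` in the domination inequality (no axis). -/
def extRest3 (J : Fin 3 → Fin 3 × Fin 3 → ℤ) (cC wC cH wH : Bx) (ch : List (Bx × Bx × (Fin 3 → Fin 3 → ℤ) × ℤ)) (lmin r : ℤ) (c w : Bx) : Bool :=
  sameU c w cC wC && sameU c w cH wH && xiBallOK cH wH && jacOK J wC && decide (htK cH wH < (SC : ℤ)) && htROKU cH wH &&
  htNaiOKA2 cC wC J (htBU cH wH) && decide (0 < ch.length) && extFloorAll ch lmin && extGeomOK cC wC ch c w &&
  xiSub cC wC cH wH && xiSub c w cH wH && decide (0 < r) && decide (0 ≤ lmin) &&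
  decide (4 * (SC : ℤ) ^ 2 * 8892 * 279936 + 4 * (SC : ℤ) * htGsA2 cC wC J (htBU cH wH) * 230539333248 +
      4 * (SC : ℤ) ^ 2 * ((htRU cH wH).length : ℤ) * 823543 < 4 * lmin * r * 230539333248)

/-- ★ **THE TUBE-RADIUS EXTERIOR LEAF** `exteriorOK3 := extRest3 && extCurvAll`. Computable. -/
def exteriorOK3 (J : Fin 3 → Fin 3 × Fin 3 → ℤ) (cC wC cH wH : Bx) (ch : List (Bx × Bx × (Fin 3 → Fin 3 → ℤ) × ℤ)) (lmin r : ℤ) (c w : Bx) : Bool :=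
  extRest3 J cC wC cH wH ch lmin r c w && extCurvAll (htBU cH wH) ch

/-- PARTS: the cheap rest + the per-box curvature facts ⟹ the leaf. [formal bookkeeping] -/
theorem exteriorOK3_of_parts {J : Fin 3 → Fin 3 × Fin 3 → ℤ} {cC wC cH wH : Bx} {ch : List (Bx × Bx × (Fin 3 → Fin 3 → ℤ) × ℤ)} {lmin r : ℤ}
    {c w : Bx} (hrest : extRest3 J cC wC cH wH ch lmin r c w = true)
    (hcurv : ∀ k, k < ch.length → curvCheckLJM (chC ch k) (chW ch k) ((htBU cH wH).filter fun b => ljLabelOK (chC ch k) (chW ch k) b)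
      ((htBU cH wH).filter fun b => !ljLabelOK (chC ch k) (chW ch k) b) (chD ch k) (chL ch k) = true) :
    exteriorOK3 J cC wC cH wH ch lmin r c w = true := by
  unfold exteriorOK3 extCurvAll
  simp only [Bool.and_eq_true, List.all_eq_true, List.mem_range]
  exact ⟨hrest, hcurv⟩

/-- ★ **FAR SOUNDNESS of the tube-radius exterior leaf**: the `hver` conclusion at every level `μ` for every admissible `(U, ξ)` of the box lying at
`M`-distance at least `r/SC` from the cell's affine sheet point `affShuf J cC U`. [folklore chaining: v2's proof with the far hypothesis in place of the gap] -/
theorem exteriorOK3_sound_far {μ : ℤ} {J : Fin 3 → Fin 3 × Fin 3 → ℤ} {cC wC cH wH : Bx} {ch : List (Bx × Bx × (Fin 3 → Fin 3 → ℤ) × ℤ)} {lmin r : ℤ}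
    {c w : Bx} (h : exteriorOK3 J cC wC cH wH ch lmin r c w = true) (U : E3 →L[ℝ] E3) (ξ : E3)
    (_hsa : ∀ v v' : E3, ⟪U v, v'⟫ = ⟪v, U v'⟫) (hU : ‖U - 1‖ ≤ 1 / 4)
    (hbox : ∀ ab : Fin 3 × Fin 3, |(U (EuclideanSpace.single ab.2 (1 : ℝ))) ab.1 - (c (Sum.inl ab) : ℝ) / SC| ≤ (w (Sum.inl ab) : ℝ) / SC)
    (hξ : ∀ i : Fin 3, |ξ i - (c (Sum.inr i) : ℝ) / SC| ≤ (w (Sum.inr i) : ℝ) / SC) (_h0 : 0 ≤ ξ 0) (_h2 : 0 ≤ ξ 2)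
    (hfar : (r : ℝ) / SC ≤ ‖U (ξ - affShuf J cC U)‖) :
    (∀ (M : ℕ) (z : Fin M → E3) (cc : Fin M), Function.Injective z →
        Set.range z = {x : E3 | dist x (z cc) ≤ 133 / 10 ∧ ∃ a : Fin 3 → ℤ,
          x = z cc + latPt U hexFrame a ∨ x = z cc + latPt U hexFrame a + U (hcpShift + ξ)} →
        TightNearCap (9 / 5) (3 / 2) z cc ∨ ExemptNear (9 / 5) ExRec z cc ∨ BadNearCap (9 / 5) (3 / 2) z cc) ∨
      (μ : ℝ) / SC ≤ ∑ b ∈ (Fintype.piFinset fun _ : Fin 3 => Finset.Icc (-7 : ℤ) 7).filter (fun b => b ≠ 0), effPot w₄₅ ω₄ (3 / 400) ‖latPt U hexFrame b‖ +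
        ∑ b ∈ (Fintype.piFinset fun _ : Fin 3 => Finset.Icc (-7 : ℤ) 7), effPot w₄₅ ω₄ (3 / 400) ‖latPt U hexFrame b + U (hcpShift + ξ)‖ := by
  classical
  have hS : (0 : ℝ) < SC := SC_pos
  unfold exteriorOK3 extRest3 at h
  simp only [Bool.and_eq_true, decide_eq_true_eq] at h
  obtain ⟨⟨⟨⟨⟨⟨⟨⟨⟨⟨⟨⟨⟨⟨⟨hUC, hUH⟩, hball⟩, hjac⟩, hKlt⟩, hROK⟩, hNai⟩, hlen⟩, hfloors⟩, hgeom⟩, hCH⟩, hSH⟩, hr⟩, hlmin⟩, hdomZ⟩, hcurvs⟩ := h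
  -- entry boxes
  have hboxC := hbox_of_sameU hUC hbox
  have hboxH := hbox_of_sameU hUH hbox
  -- the reference: the cell's affine sheet point
  set ξ₀ : E3 := affShuf J cC U with hξ₀def
  have hξ₀C : ∀ m : Fin 3, |ξ₀ m - (cC (Sum.inr m) : ℝ) / SC| ≤ (wC (Sum.inr m) : ℝ) / SC := by
    intro m
    refine (abs_affShuf_sub_le (J := J) (w := wC) U hboxC m).trans ?_
    rw [div_le_div_iff_of_pos_right hS]
    exact_mod_cast jacOK_spec hjac m
  have hξ₀H := hxi_of_xiSub hCH hξ₀C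
  have hξH := hxi_of_xiSub hSH hξ
  have hn₀ : ‖ξ₀‖ ≤ 1 / 4 := norm_le_quarter_of_xiBallOK hball hξ₀H
  have hn : ‖ξ‖ ≤ 1 / 4 := norm_le_quarter_of_xiBallOK hball hξH
  -- label finsets from the HULL box (verbatim the cell proof's block at (cH, wH))
  set B : Finset (Fin 3 → ℤ) := (htBU cH wH).toFinset with hBdef
  set R : Finset (Fin 3 → ℤ) := (htRU cH wH).toFinset with hRdef
  have hB : B ⊆ Fintype.piFinset fun _ : Fin 3 => Finset.Icc (-11 : ℤ) 11 := by
    intro b hb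
    rw [← boxLabels11_toFinset]
    exact List.mem_toFinset.2 (mem_boxLabels11_of_mem_htUniv (mem_htUniv_of_mem_htBU (List.mem_toFinset.1 hb)))
  have hBin : ∀ bb ∈ B, ‖latPt U hexFrame bb + U (hcpShift + ξ)‖ ≤ 7 :=
    fun bb hbb => norm_le_seven_of_htIn U hboxH ξ hξH (htIn_of_mem_htBU (List.mem_toFinset.1 hbb))
  have hROK' : ∀ b ∈ htRU cH wH, 36 * (SC : ℤ) ≤ (fjQ cH wH b).lo := by
    intro b hb
    have := List.all_eq_true.1 hROK b hb
    simpa using this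
  have hR : ∀ bb ∈ (Fintype.piFinset fun _ : Fin 3 => Finset.Icc (-11 : ℤ) 11) \ B, ‖latPt U hexFrame bb + U (hcpShift + ξ)‖ ≤ 7 →
      bb ∈ R ∧ 6 ≤ ‖latPt U hexFrame bb + U (hcpShift + ξ)‖ := by
    intro bb hbb h7
    obtain ⟨hbox11, hnotB⟩ := Finset.mem_sdiff.1 hbb
    rw [← boxLabels11_toFinset] at hbox11
    have hbL : bb ∈ boxLabels11 := List.mem_toFinset.1 hbox11
    have hlo := lo_le_of_norm_le_seven U hboxH ξ hξH h7
    by_cases huniv : bb ∈ htUniv cH wH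
    swap
    · exact absurd h7 (not_le.2 (seven_lt_norm_of_not_mem_htUniv U hboxH hξH hKlt hbL huniv))
    by_cases hin : htIn cH wH bb = true
    · exact absurd (List.mem_toFinset.2 (mem_htBU_of_htIn huniv hin)) hnotB
    · have hmemR : bb ∈ htRU cH wH := by
        refine List.mem_filter.2 ⟨huniv, ?_⟩
        simp only [Bool.and_eq_true, Bool.not_eq_true', decide_eq_true_eq]
        exact ⟨by simpa using hin, hlo⟩
      exact ⟨List.mem_toFinset.2 hmemR, six_le_norm_of_lo U hboxH ξ hξH (hROK' bb hmemR)⟩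
  -- the slope bound at the reference over B (second-order centred chunk with L := htBU hull at the CELL box)
  have hf₀ := refForce_chunkA2_le (htBU_nodup cH wH) hNai U hU hboxC (by simpa [hξ₀def] using hn₀) ξ
  rw [← hBdef] at hf₀
  -- the chain
  set m : ℕ := ch.length with hmdef
  have hm : 0 < m := hlen
  simp only [extCurvAll, List.all_eq_true, List.mem_range] at hcurvs
  simp only [extFloorAll, List.all_eq_true, List.mem_range] at hfloors
  simp only [extGeomOK, List.all_eq_true, List.mem_range, Bool.and_eq_true, decide_eq_true_eq] at hgeom
  obtain ⟨⟨⟨hsameK, hC0⟩, hSlast⟩, hnestK⟩ := hgeom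
  have hLB : ∀ k, k < m → ((htBU cH wH).filter (fun b => ljLabelOK (chC ch k) (chW ch k) b) ++
      (htBU cH wH).filter (fun b => !ljLabelOK (chC ch k) (chW ch k) b)).toFinset = B :=
    fun k _ => by rw [hBdef]; exact toFinset_filter_append _ _
  have hnd : ∀ k, k < m → ((htBU cH wH).filter (fun b => ljLabelOK (chC ch k) (chW ch k) b) ++
      (htBU cH wH).filter (fun b => !ljLabelOK (chC ch k) (chW ch k) b)).Nodup :=
    fun k _ => nodup_filter_append (htBU_nodup cH wH) _
  have hchk : ∀ k, k < m → curvCheckLJM (chC ch k) (chW ch k) ((htBU cH wH).filter fun b => ljLabelOK (chC ch k) (chW ch k) b)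
      ((htBU cH wH).filter fun b => !ljLabelOK (chC ch k) (chW ch k) b) (chD ch k) (chL ch k) = true :=
    fun k hk => hcurvs k hk
  have hUbox : ∀ k, k < m → ∀ ab : Fin 3 × Fin 3,
      |(U (EuclideanSpace.single ab.2 (1 : ℝ))) ab.1 - (chC ch k (Sum.inl ab) : ℝ) / SC| ≤ (chW ch k (Sum.inl ab) : ℝ) / SC :=
    fun k hk => hbox_of_sameU (hsameK k hk) hbox
  have hnest : ∀ k, k + 1 < m → ∀ j : Fin 3, chC ch (k + 1) (Sum.inr j) - chW ch (k + 1) (Sum.inr j) ≤ chC ch k (Sum.inr j) - chW ch k (Sum.inr j) ∧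
      chC ch k (Sum.inr j) + chW ch k (Sum.inr j) ≤ chC ch (k + 1) (Sum.inr j) + chW ch (k + 1) (Sum.inr j) := by
    intro k hk j
    have h' := hnestK k (by omega) hk
    simp only [xiSub, decide_eq_true_eq] at h'
    exact h' j
  have h0 := hxi_of_xiSub hC0 hξ₀C
  have h1 := hxi_of_xiSub hSlast hξ
  -- the far hypothesis: hΔ and the domination
  have hrpos : (0 : ℝ) < (r : ℝ) / SC := div_pos (by exact_mod_cast hr) hS
  have hΔ : U (ξ - ξ₀) ≠ 0 := by
    intro h0
    rw [h0, norm_zero] at hfar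
    linarith
  have hℓ : ∀ k, k < m → ((lmin : ℝ) / SC) * ‖U (ξ - ξ₀)‖ ^ 2 ≤
      (chL ch k : ℝ) / SC * ‖U (ξ - ξ₀)‖ ^ 2 + ∑ i : Fin 3, ∑ j : Fin 3, (chD ch k i j : ℝ) / SC * ((U (ξ - ξ₀)) i * (U (ξ - ξ₀)) j) :=
    fun k hk => floorOK_sound (hfloors k hk) _
  -- the domination inequality from the integers
  have hRcard : (R.card : ℝ) ≤ ((htRU cH wH).length : ℝ) := by
    rw [hRdef]; exact_mod_cast List.toFinset_card_le _
  have hS7 : (6000 / 343 * (7 : ℝ)⁻¹ ^ 4 + 2880 / 49 * (7 : ℝ)⁻¹ ^ 5 + 10 / 7 * (7 : ℝ)⁻¹ ^ 6 + 2 * (7 : ℝ)⁻¹ ^ 7) = 8892 / 823543 := by norm_num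
  have h67 : ((6 : ℝ)⁻¹ ^ 7) = 1 / 279936 := by norm_num
  have hZ : (4 * (SC : ℝ) ^ 2 * 8892 * 279936 + 4 * (SC : ℝ) * (htGsA2 cC wC J (htBU cH wH) : ℝ) * 230539333248 +
      4 * (SC : ℝ) ^ 2 * ((htRU cH wH).length : ℝ) * 823543) < 4 * (lmin : ℝ) * (r : ℝ) * 230539333248 := by exact_mod_cast hdomZ
  have hlmin0 : (0 : ℝ) ≤ (lmin : ℝ) / SC := div_nonneg (by exact_mod_cast hlmin) hS.le
  have hK : (6000 / 343 * (7 : ℝ)⁻¹ ^ 4 + 2880 / 49 * (7 : ℝ)⁻¹ ^ 5 + 10 / 7 * (7 : ℝ)⁻¹ ^ 6 + 2 * (7 : ℝ)⁻¹ ^ 7) +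
      (htGsA2 cC wC J (htBU cH wH) : ℝ) / SC + R.card * (6 : ℝ)⁻¹ ^ 7 < (lmin : ℝ) / SC * ((r : ℝ) / SC) := by
    rw [hS7, h67]
    have hSC : (SC : ℝ) = 281474976710656 := by norm_num [SC]
    rw [hSC] at hZ ⊢
    have hR67 : (R.card : ℝ) * (1 / 279936) ≤ ((htRU cH wH).length : ℝ) * (1 / 279936) := mul_le_mul_of_nonneg_right hRcard (by norm_num)
    nlinarith [hZ, hR67]
  have hdom := hK.trans_le (mul_le_mul_of_nonneg_left hfar hlmin0)
  -- assemble
  exact hver_exterior_of_curvChecks_uniformFloor (μ := μ) hU hn₀ hn B R hB hBin hR hf₀ m hm (chC ch) (chW ch)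
    (fun k => (htBU cH wH).filter fun b => ljLabelOK (chC ch k) (chW ch k) b) (fun k => (htBU cH wH).filter fun b => !ljLabelOK (chC ch k) (chW ch k) b)
    (chD ch) (chL ch) hLB hnd hchk hUbox hnest h0 h1 hΔ hℓ hdom

/-! ## §2 The near configurations lie in the backing cell box -/

/-- Same `U`-box as the cell and as the backing box, and the integer tube containment `[cC ± (jw + 4r/3)] ⊆ [cN ± wN]` on the three shuffle axes. -/
def tubeBoxOK (J : Fin 3 → Fin 3 × Fin 3 → ℤ) (cC wC : Bx) (r : ℤ) (cN wN c w : Bx) : Bool :=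
  sameU c w cC wC && sameU c w cN wN &&
  decide (∀ m : Fin 3, 4 * r ≤ 3 * ((cC (Sum.inr m) - jw J wC m) - (cN (Sum.inr m) - wN (Sum.inr m))) ∧
    4 * r ≤ 3 * ((cN (Sum.inr m) + wN (Sum.inr m)) - (cC (Sum.inr m) + jw J wC m)))

/-- A coordinate is bounded by the Euclidean norm. [folklore] -/
private theorem abs_coord_le_norm3 (v : E3) (i : Fin 3) : |v i| ≤ ‖v‖ := by
  have h := EuclideanSpace.norm_eq v
  rw [h]
  have : |v i| = Real.sqrt (‖v i‖ ^ 2) := by rw [Real.sqrt_sq (norm_nonneg _)]; rfl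
  rw [this]
  exact Real.sqrt_le_sqrt (Finset.single_le_sum (fun j _ => sq_nonneg ‖v j‖) (Finset.mem_univ i))

/-- ★ **NEAR ⟹ IN THE BACKING BOX**: `‖U − 1‖ ≤ 1/4`, the reference within `jw` of `cC`, `‖U(ξ − ξ₀)‖ < r/SC` and the integer tube containment put every
shuffle coordinate of `ξ` in the backing box. [arithmetic: `‖v‖ ≤ (4/3)‖Uv‖`, coordinates ≤ norm] -/
theorem xi_mem_of_near {U : E3 →L[ℝ] E3} (hU : ‖U - 1‖ ≤ 1 / 4) {ξ ξ₀ : E3} {J : Fin 3 → Fin 3 × Fin 3 → ℤ} {cC wC cN wN : Bx} {r : ℤ}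
    (hξ₀J : ∀ m : Fin 3, |ξ₀ m - (cC (Sum.inr m) : ℝ) / SC| ≤ (jw J wC m : ℝ) / SC) (hnear : ‖U (ξ - ξ₀)‖ < (r : ℝ) / SC)
    (ht : ∀ m : Fin 3, 4 * r ≤ 3 * ((cC (Sum.inr m) - jw J wC m) - (cN (Sum.inr m) - wN (Sum.inr m))) ∧
      4 * r ≤ 3 * ((cN (Sum.inr m) + wN (Sum.inr m)) - (cC (Sum.inr m) + jw J wC m))) :
    ∀ m : Fin 3, |ξ m - (cN (Sum.inr m) : ℝ) / SC| ≤ (wN (Sum.inr m) : ℝ) / SC := by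
  intro m
  have hS : (0 : ℝ) < SC := SC_pos
  have hSC : (SC : ℝ) = 281474976710656 := by norm_num [SC]
  have h34 := norm_apply_ge_of_near_one hU (ξ - ξ₀)
  have hcm : |ξ m - ξ₀ m| ≤ ‖ξ - ξ₀‖ := by
    have := abs_coord_le_norm3 (ξ - ξ₀) m
    simpa only [PiLp.sub_apply] using this
  have hA : |ξ m - ξ₀ m| < 4 / 3 * ((r : ℝ) / SC) := by linarith
  have hB : |(ξ m - ξ₀ m) * SC| < 4 / 3 * (r : ℝ) := by
    rw [abs_mul, abs_of_pos hS]
    have := mul_lt_mul_of_pos_right hA hS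
    have e : 4 / 3 * ((r : ℝ) / SC) * SC = 4 / 3 * (r : ℝ) := by field_simp
    linarith
  obtain ⟨hB1, hB2⟩ := abs_lt.1 hB
  obtain ⟨hC1, hC2⟩ := mulSC_bounds_of_abs_le (hξ₀J m)
  have ht1 : (4 : ℝ) * r ≤ 3 * (((cC (Sum.inr m) : ℝ) - (jw J wC m : ℝ)) - ((cN (Sum.inr m) : ℝ) - (wN (Sum.inr m) : ℝ))) := by
    exact_mod_cast (ht m).1
  have ht2 : (4 : ℝ) * r ≤ 3 * (((cN (Sum.inr m) : ℝ) + (wN (Sum.inr m) : ℝ)) - ((cC (Sum.inr m) : ℝ) + (jw J wC m : ℝ))) := by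
    exact_mod_cast (ht m).2
  refine abs_le_of_mulSC_bounds ?_ ?_
  · rw [hSC] at hB1 hC1 ⊢
    nlinarith
  · rw [hSC] at hB2 hC2 ⊢
    nlinarith

/-! ## §3 ★★★ The cell-backed leaf is a semantic fact -/

/-- ★★★ **THE CELL-BACKED EXTERIOR LEAF IS A SEMANTIC FACT AT EVERY LEVEL**: the backing box's semantic fact (`hN`, the adjacent cell's own certificate),
the tube-radius exterior certificate of the leaf box and the integer tube containment certify the leaf box — near configurations by the cell, far ones
by ray domination. [formal bookkeeping + folklore chaining] -/
theorem semOKH_of_cellBacked {μ : ℤ} {J : Fin 3 → Fin 3 × Fin 3 → ℤ} {cC wC cH wH : Bx} {ch : List (Bx × Bx × (Fin 3 → Fin 3 → ℤ) × ℤ)}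
    {lmin r : ℤ} {cN wN c w : Bx} (hN : semOKH μ cN wN = true) (h3 : exteriorOK3 J cC wC cH wH ch lmin r c w = true)
    (ht : tubeBoxOK J cC wC r cN wN c w = true) : semOKH μ c w = true := by
  refine semOKH_of_forall fun U ξ hsa hU hcoord h0 h2 => ?_
  obtain ⟨hbox, hξ⟩ := (inHcpBox_iff c w U ξ).1 hcoord
  by_cases hfar : (r : ℝ) / SC ≤ ‖U (ξ - affShuf J cC U)‖
  · exact exteriorOK3_sound_far h3 U ξ hsa hU hbox hξ h0 h2 hfar
  · simp only [tubeBoxOK, Bool.and_eq_true, decide_eq_true_eq] at ht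
    obtain ⟨⟨hUC, hUN⟩, htube⟩ := ht
    have hboxC := hbox_of_sameU hUC hbox
    have hboxN := hbox_of_sameU hUN hbox
    have hξ₀J : ∀ m : Fin 3, |affShuf J cC U m - (cC (Sum.inr m) : ℝ) / SC| ≤ (jw J wC m : ℝ) / SC :=
      fun m => abs_affShuf_sub_le (J := J) (w := wC) U hboxC m
    have hξN := xi_mem_of_near hU hξ₀J (not_le.1 hfar) htube
    exact semOKH_forall hN U ξ hsa hU ((inHcpBox_iff cN wN U ξ).2 ⟨hboxN, hξN⟩) h0 h2

/-! ## §4 The seven-kind column menu -/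

/-- The cell-backed leaf check against the LISTED backing cell `L[n]`; `e.g` is read as the tube radius `r`, `e.i` is unused. Computable. -/
def cellBackedAt (L : List (Bx × Bx)) (n : ℕ) (e : ExtLeafData) (c w : Bx) : Bool :=
  match L[n]? with
  | some b => tubeBoxOK e.J e.cC e.wC e.g b.1 b.2 c w && exteriorOK3 e.J e.cC e.wC e.cH e.wH e.ch e.lmin e.g c w
  | none => false

/-- Soundness of the listed cell-backed leaf. [formal bookkeeping] -/
theorem cellBackedAt_sound {μ : ℤ} (L : List (Bx × Bx)) (hL : ∀ b ∈ L, semOKH μ b.1 b.2 = true) (n : ℕ) (e : ExtLeafData) (c w : Bx)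
    (h : cellBackedAt L n e c w = true) : semOKH μ c w = true := by
  unfold cellBackedAt at h
  split at h
  · rename_i b hb
    simp only [Bool.and_eq_true] at h
    exact semOKH_of_cellBacked (hL b (List.mem_of_getElem? hb)) h.2 h.1
  · exact absurd h Bool.false_ne_true

/-- **THE SEVEN-KIND COLUMN LEAF MENU**: `colLeaf6`'s six kinds + `(n, e)` = cell-backed exterior leaf backed by the listed cell `L[n]`. Computable. -/
def colLeaf7 (L : List (Bx × Bx)) (μ₀ : ℤ) :
    ℕ ⊕ (Unit ⊕ (ExtLeafData ⊕ (AnnLeafData ⊕ (ExtLeafData ⊕ (AnnLeafData ⊕ (ℕ × ExtLeafData)))))) → Bx → Bx → Bool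
  | .inl i, c, w => coveredAt L i c w
  | .inr (.inl _), c, w => entryLeafOKHC μ₀ c w
  | .inr (.inr (.inl e)), c, w => exteriorOK e.J e.cC e.wC e.cH e.wH e.ch e.lmin e.g e.i c w
  | .inr (.inr (.inr (.inl a))), c, w => annulusOK a.J a.cC a.wC a.cH a.wH a.ch a.ll a.den a.na a.nb a.g a.i c w
  | .inr (.inr (.inr (.inr (.inl e)))), c, w => exteriorOK2 e.J e.cC e.wC e.cH e.wH e.ch e.lmin e.g e.i c w
  | .inr (.inr (.inr (.inr (.inr (.inl a))))), c, w => annulusOK2 a.J a.cC a.wC a.cH a.wH a.ch a.ll a.den a.na a.nb a.g a.i c w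
  | .inr (.inr (.inr (.inr (.inr (.inr ne))))), c, w => cellBackedAt L ne.1 ne.2 c w

/-- ★★ **THE SEVEN-KIND MENU FOLD.** [formal bookkeeping] -/
theorem semOKH_of_cutOK_colLeaf7 {μ μ₀ : ℤ} (hle : μ ≤ μ₀) (L : List (Bx × Bx)) (hL : ∀ b ∈ L, semOKH μ b.1 b.2 = true) :
    ∀ (t : CutTree ((Fin 3 × Fin 3) ⊕ Fin 3) (ℕ ⊕ (Unit ⊕ (ExtLeafData ⊕ (AnnLeafData ⊕ (ExtLeafData ⊕ (AnnLeafData ⊕ (ℕ × ExtLeafData))))))))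
      (c w : Bx), cutOK (colLeaf7 L μ₀) t c w = true → semOKH μ c w = true :=
  semOKH_of_cutOK_leaves (colLeaf7 L μ₀) fun a c w h => by
    rcases a with i | u | e | a | e | a | ne
    · exact coveredAt_sound (semOKH μ) (fun _ _ _ _ hc h => semOKH_anti_box hc h) L hL i c w h
    · exact semOKH_of_entryLeafOKHC_level hle h
    · exact semOKH_of_exteriorOK h μ
    · exact semOKH_of_annulusOK h μ
    · exact semOKH_of_exteriorOK2 h μ
    · exact semOKH_of_annulusOK2 h μ
    · exact cellBackedAt_sound L hL ne.1 ne.2 c w h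

/-- ★★★ **THE hcp ROOT FACT FROM A SEVEN-KIND COLUMN MANIFEST** (cells, kernel leaves, v1/v2 exterior and annulus leaves, cell-backed leaves). [formal bookkeeping] -/
theorem semOKH_root_of_colManifest7 {μ μ₀ : ℤ} (hle : μ ≤ μ₀) (L : List (Bx × Bx)) (hL : ∀ b ∈ L, semOKH μ b.1 b.2 = true)
    (t : CutTree ((Fin 3 × Fin 3) ⊕ Fin 3) (ℕ ⊕ (Unit ⊕ (ExtLeafData ⊕ (AnnLeafData ⊕ (ExtLeafData ⊕ (AnnLeafData ⊕ (ℕ × ExtLeafData))))))))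
    (h : cutOK (colLeaf7 L μ₀) t rootCH rootWH = true) : semOKH μ rootCH rootWH = true :=
  semOKH_of_cutOK_colLeaf7 hle L hL t rootCH rootWH h

end Summit.AtomisticToContinuum.Crystallization.Theorems.FrustratedLawDichotomyStrainedPatchHomExteriorRay

end
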